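import Summits.Schanuel.Schanuel.Theorems.RootDecomp1KParamThueMahler01

/-!
# RootDecomp1KParamThueMahler — lens 1, generation 56, NODE 17 «SIEGEL GENUS 0 ON THE K-LINE (Thue–Mahler on the parameter line)» (RULE K-R47 payable clause; CLAIM L2669, PRICE L2670, VERDICT L2680, K-R48) — continuation (RootDecomp1KParamThueMahler02): §3 the family Qa a: class membership, x-presentation, uniform territory certificates

(lens-1 g56 NODE 17 HOME kernel K2 = HOME/decomp-schanuel-lens-1/g56/ParamThueMahler.lean 6128daf4…, 642 l, 87 thm + 8 def, imports tree …RootDecomp1KThueMahler04 ONLY = the port of node 16 (no Literature import, no fact def, no private / set_option); Probe / Ctrl0 / Ctrl + NODE-g56b.md + presearch_g56b.txt + SHA256SUMS; CLAIM L2669, crit EX-ANTE PRICE L2670 (ONE THEOREM ×1 under K-R47's payable clause «an infinite class of RE-AMENDED-FRONTIER pairs of x-degree ≥ 2 made unconditional … by a record input provably reaching where the record could not» iff CHECKLIST K-g56b; RULE K-R48 pre-announced), lens INFO L2671, NODE L2677, critic VERDICT L2680: CLEARED — THEOREM ×1 under K-R47's payable clause (EX-ANTE PRICE L2670), CHECKLIST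 K-g56b (1)–(10) MET, with ONE POST-HOC CONDITION OF RECORD (census files the LIVENESS rows «node17 Q17 / Qa 0 / Qa 1», key xParamTM, reading «rate 1 / exp ½ ⇒ FRONTIER at m₀ = 2, not x-linear, not killed» — FILED as census/LIVENESS-v7 e94537bf…/9b531c72…, INSTRUMENT NOTE 7 L2683: the rows read exactly so); RULE K-R48 FIXED (toolkit of record ∪= rational-uniformisation transfer (`XParamTM` shape, `param_of_point`) feeding `finite_dyadicPts`; FRONTIER re-amended by «NOT XParamTM-level-finite»; open territory of record at m₀ = 2 := re-amended-frontier pairs of x-degree ≥ 2 that are NOT XParamTM — positive-genus rate-1 members, standing witness M17P; UNCONDITIONAL PART := DecidedAt ∨ MachineDecidedAt ∨ LocalAt ∨ GaussAt ∨ XLinTM ∨ XParamTM); PORT GO (K2 verbatim; docstrings/provenance only; «cite-token» spelling; dedup 0; identity diff + tree farm by the successor critic crit-1 g10). Port by census-1 gen 22 as `RootDecomp1KParamThueMahler01–03` (`--supports stmt-Schanuel-33364`; no census credit): 01 = §1 the x-UNIFORMISED CLASS **`XParamTM P`** (∃ U V ∈ ℤ[t], V ℚ-separable, 3 ≤ deg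 V, deg U ≤ deg V, U ⊥ V, ∃ E : Finset ℚ, ∀ C, ∃ C', every bounded non-degenerate rational point (x, r), x ∈ ℚ, has r ∈ E or x = U(t)/V(t) for some |t| ≤ C' with V(t) ≠ 0) and THEOREM A **`levelFinite_of_xParamTM : XParamTM P → LevelFinite P`**, `thinFibreAt_of_xParamTM` (every m₀), `xParamTM_of_xLinTM`, bridge `dyadicPt_of_level_param` into node 16's `finite_dyadicPts` + §2 THE SQUARE-ROOT UNIFORMISED CURVES `sqrtParamP U₀ U₁ V₀ V₁ = (U₀(Y) − x·V₀(Y))² − Y·(x·V₁(Y) − U₁(Y))²`, `twist`, `excR`, `param_of_point`, THEOREM B **`xParamTM_sqrtParamP`**, `levelFinite_sqrtParamP`, `thinFibreAt_sqrtParamP`; 02 = §3 the INFINITE x-DEGREE-2 FAMILY **`Qa a := sqrtParamP (C a) 1 (X² + C 2) 1`** (U = t + a, V = t⁴ + t + 2; common top Y⁴ + 4Y² − Y + 4): `xParamTM_Qa`, `levelFinite_Qa`, **`thinFibreAt_Qa (a) (m₀)` HYP-FREE**, the x-presentation `Qa_eq_xPolyP` / `qC` and the UNIFORM territory certificates `not_decidedAt_two_Qa`,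 `not_localAt_Qa`, `not_gaussAt_Qa`, `not_heightDecidedAt_two_Qa`, `not_xLinTM_Qa`, `Qa_ne_twoTermP`, `Qa_ne_normShapeCurve`, `sepTopAt_two_Qa`, `Qa_injective`, **`Qa_territory`**; 03 = the showcase member **`Q17 = Qa 3 = x²(Y⁴ + 4Y² − Y + 4) − 2x(3Y² − Y + 6) + (9 − Y)`**: `thinFibreAt_Q17_all`, `Q17_territory`, `natDegree_Qa_eq_two_mul_xdeg` (the machine cap as an equality). PORT EDITS: 45 one-line docstrings on undocumented computation lemmas (statements quoted); otherwise none (no dedup twin: K2's `abs_le_of_sq_le` is a different statement from `RootDecomp1KLevelFinite.abs_le_of_sq_le` and resolves in K2's own namespace exactly as in the lens's farm run; no private, no set_option, no cite-token in a def docstring); provenance doc blocks + continuation headers = K2's own open-lines; statements and proofs VERBATIM. Rung 0 — nothing here proves Schanuel, 33364, 33363, 31077 or ThinFibre 2; the class, the family and the member are HYPOTHESIS-FREE; M17P (positive genus) does not move.)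
-/

noncomputable section

namespace Summit.Schanuel.Schanuel.Theorems.RootDecomp1KParamThueMahler

open Polynomial LiouvilleNumber
open scoped Nat
open Summit.Schanuel.Schanuel.Theorems.RootDecomp1KTwoBaseCell (psNumer)
open Summit.Schanuel.Schanuel.Theorems.RootDecomp1KDegreeLadder
open Summit.Schanuel.Schanuel.Theorems.RootDecomp1KXLinear
open Summit.Schanuel.Schanuel.Theorems.RootDecomp1KXLinearII
open Summit.Schanuel.Schanuel.Theorems.RootDecomp1KXAll
open Summit.Schanuel.Schanuel.Theorems.RootDecomp1KLevelFinite
open Summit.Schanuel.Schanuel.Theorems.RootDecomp1KSubspaceBranch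
open Summit.Schanuel.Schanuel.Theorems.RootDecomp1KXTop
open Summit.Schanuel.Schanuel.Theorems.RootDecomp1KLocalExponent
open Summit.Schanuel.Schanuel.Theorems.RootDecomp1KIntegrality
open Summit.Schanuel.Schanuel.Theorems.RootDecomp1KHeightGrading
open Summit.Schanuel.Schanuel.Theorems.RootDecomp1KHeightMachine
open Summit.Schanuel.Schanuel.Theorems.RootDecomp1KRelLiouvilleCell (partialSum_two_strictMono)
open Summit.Schanuel.Schanuel.Theorems.RootDecomp1KThueMahler

/-! ## §3  THE INFINITE x-DEGREE-2 FAMILY `Qa a` (`a : ℤ`): `U = t + a`, `V = t⁴ + t + 2`, common top `Y⁴ + 4Y² − Y + 4` -/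

/-- `twist (Y² + 2) 1 = t⁴ + t + 2`. -/
theorem twist_vQ : twist (X ^ 2 + C 2) 1 = X ^ 4 + X + C 2 := by
  rw [twist, map_add, map_pow, expand_X, expand_C, map_one, mul_one]; ring

/-- `twist (C a) 1 = t + a`. -/
theorem twist_uQ (a : ℤ) : twist (C a) 1 = X + C a := by
  rw [twist, expand_C, map_one, mul_one, add_comm]

/-- `(X ^ 4 + X + C 2 : ℤ[X]).natDegree = 4`. -/
theorem natDegree_vQ : (X ^ 4 + X + C 2 : ℤ[X]).natDegree = 4 := by compute_degree!

/-- `(X + C a : ℤ[X]).natDegree = 1`. -/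
theorem natDegree_uQ (a : ℤ) : (X + C a : ℤ[X]).natDegree = 1 := natDegree_X_add_C a

/-- `t⁴ + t + 2` is separable over `ℚ` (`2021 = 4(36t² − 96t + 256)·V − (27 + t(36t² − 96t + 256))·V'`). -/
theorem separable_vQ : ((X ^ 4 + X + C 2 : ℤ[X]).map (Int.castRingHom ℚ)).Separable := by
  rw [Polynomial.separable_def]
  have hV : (X ^ 4 + X + C 2 : ℤ[X]).map (Int.castRingHom ℚ) = X ^ 4 + X + C 2 := by
    rw [Polynomial.map_add, Polynomial.map_add, Polynomial.map_pow, map_X, map_C]; rfl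
  rw [hV]
  refine (Polynomial.isCoprime_iff_aeval_ne_zero_of_isAlgClosed (k := ℚ) (K := ℂ) _ _).mpr fun z => ?_
  by_contra h
  simp only [not_or, not_not, derivative_X_pow, derivative_X, derivative_C, map_add, map_pow, map_mul, aeval_X, aeval_C,
    map_natCast, aeval_one, add_zero] at h
  simp only [eq_ratCast, Rat.cast_ofNat, Nat.cast_ofNat] at h
  obtain ⟨h1, h2⟩ := h
  have : (2021 : ℂ) = 0 := by
    linear_combination (4 * (36 * z ^ 2 - 96 * z + 256)) * h1 - (27 + z * (36 * z ^ 2 - 96 * z + 256)) * h2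
  norm_num at this

/-- `t + a ⊥ t⁴ + t + 2` over `ℚ` for EVERY `a ∈ ℤ` (`a⁴ − a + 2 > 0`). -/
theorem isCoprime_uQ_vQ (a : ℤ) :
    IsCoprime ((X + C a : ℤ[X]).map (Int.castRingHom ℚ)) ((X ^ 4 + X + C 2 : ℤ[X]).map (Int.castRingHom ℚ)) := by
  refine (Polynomial.isCoprime_iff_aeval_ne_zero_of_isAlgClosed (k := ℚ) (K := ℂ) _ _).mpr fun z => ?_
  by_contra h
  simp only [not_or, not_not, ← algebraMap_int_eq, aeval_map_algebraMap, map_add, map_pow, aeval_X, aeval_C] at h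
  simp only [algebraMap_int_eq, eq_intCast, Int.cast_ofNat] at h
  obtain ⟨h1, h2⟩ := h
  have hz : z = -(a : ℂ) := by linear_combination h1
  rw [hz] at h2
  have h3 : ((a ^ 4 - a + 2 : ℤ) : ℂ) = 0 := by push_cast; linear_combination h2
  have h4 : (a ^ 4 - a + 2 : ℤ) = 0 := by exact_mod_cast h3
  by_cases ha : a ≤ 0
  · have : (0 : ℤ) ≤ a ^ 4 := by positivity
    omega
  · push Not at ha
    have : a ≤ a ^ 4 := by
      calc a = a * 1 := (mul_one a).symm
        _ ≤ a * a ^ 3 := mul_le_mul_of_nonneg_left (one_le_pow₀ (by omega)) ha.le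
        _ = a ^ 4 := by ring
    omega

/-- `excR (C a) 1 (Y² + 2) 1 = C a − (Y² + 2) ≠ 0` (the parameter map `(t + a)/(t⁴ + t + 2)` is not even). -/
theorem excR_Q_ne_zero (a : ℤ) : excR (C a) 1 (X ^ 2 + C 2) 1 ≠ 0 := by
  intro h
  rw [excR, mul_one, one_mul] at h
  have := congrArg (fun p : ℤ[X] => p.coeff 2) h
  simp only [coeff_sub, coeff_add, coeff_C, coeff_X_pow, coeff_zero] at this
  norm_num at this

/-- **THE FAMILY** `Qa a := sqrtParamP (C a) 1 (Y² + 2) 1 = (a − x(Y² + 2))² − Y(x − 1)²`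
`= x²(Y⁴ + 4Y² − Y + 4) − 2x(aY² − Y + 2a) + (a² − Y)`, `a ∈ ℤ`. -/
def Qa (a : ℤ) : ℤ[X][X] := sqrtParamP (C a) 1 (X ^ 2 + C 2) 1

/-- `bev (Qa a) x y = (a - x * (y ^ 2 + 2)) ^ 2 - y * (x - 1) ^ 2`. -/
theorem bev_Qa (a : ℤ) (x y : ℝ) : bev (Qa a) x y = ((a : ℝ) - x * (y ^ 2 + 2)) ^ 2 - y * (x - 1) ^ 2 := by
  rw [Qa, bev_sqrtParamP, map_add, map_pow, aeval_X, aeval_C, aeval_C, map_one]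
  simp

/-- **`XParamTM (Qa a)` for every `a ∈ ℤ`.** -/
theorem xParamTM_Qa (a : ℤ) : XParamTM (Qa a) := by
  refine xParamTM_sqrtParamP (C a) 1 (X ^ 2 + C 2) 1 ?_ ?_ ?_ ?_ (excR_Q_ne_zero a)
  · rw [twist_vQ]; exact separable_vQ
  · rw [twist_vQ, natDegree_vQ]; norm_num
  · rw [twist_vQ, twist_uQ, natDegree_vQ, natDegree_uQ]; norm_num
  · rw [twist_vQ, twist_uQ]; exact isCoprime_uQ_vQ a

/-- **`LevelFinite (Qa a)`**, hypothesis-free. -/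
theorem levelFinite_Qa (a : ℤ) : LevelFinite (Qa a) := levelFinite_of_xParamTM (xParamTM_Qa a)

/-- **`ThinFibreAt m₀ (Qa a)` for EVERY `m₀` and every `a ∈ ℤ`**, hypothesis-free. -/
theorem thinFibreAt_Qa (a : ℤ) (m₀ : ℕ) : ThinFibreAt m₀ (Qa a) := thinFibreAt_of_xParamTM (xParamTM_Qa a) m₀

/-- `ThinFibreAt 2 (Qa a)` for every `a : ℤ`, HYPOTHESIS-FREE (the re-amended-frontier value `m₀ = 2`). -/
theorem thinFibreAt_two_Qa (a : ℤ) : ThinFibreAt 2 (Qa a) := thinFibreAt_Qa a 2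

/-! ### The `x`-presentation `Qa a = Σ_{j ≤ 2} x^j·qC a j` and the territory certificates (uniform in `a`) -/

/-- the `x`-coefficients: `c₂ = Y⁴ + 4Y² − Y + 4`, `c₁ = −(2aY² − 2Y + 4a)`, `c₀ = a² − Y`. -/
def qC (a : ℤ) : ℕ → ℤ[X] := fun j =>
  if j = 2 then X ^ 4 + C 4 * X ^ 2 - X + C 4 else if j = 1 then -(C (2 * a) * X ^ 2 - C 2 * X + C (4 * a)) else C (a ^ 2) - X

/-- `qC a 2 = X ^ 4 + C 4 * X ^ 2 - X + C 4` (the common top, independent of `a`). -/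
theorem qC_two (a : ℤ) : qC a 2 = X ^ 4 + C 4 * X ^ 2 - X + C 4 := by simp [qC]
/-- `qC a 1 = -(C (2 * a) * X ^ 2 - C 2 * X + C (4 * a))`. -/
theorem qC_one (a : ℤ) : qC a 1 = -(C (2 * a) * X ^ 2 - C 2 * X + C (4 * a)) := by simp [qC]
/-- `qC a 0 = C (a ^ 2) - X`. -/
theorem qC_zero (a : ℤ) : qC a 0 = C (a ^ 2) - X := by simp [qC]

/-- the `x`-presentation `Qa a = xPolyP 2 (qC a)`. -/
theorem Qa_eq_xPolyP (a : ℤ) : Qa a = xPolyP 2 (qC a) := by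
  simp only [Qa, sqrtParamP, xPolyP, Finset.sum_range_succ, Finset.sum_range_zero, zero_add, qC_zero, qC_one,
    qC_two, pow_zero, pow_one, Polynomial.map_add, Polynomial.map_sub, Polynomial.map_mul, Polynomial.map_pow,
    Polynomial.map_neg, Polynomial.map_one, Polynomial.map_ofNat, map_X, map_C, map_ofNat, map_mul, map_pow]
  ring

/-- `qC a 2 ≠ 0`. -/
theorem qC_two_ne_zero (a : ℤ) : qC a 2 ≠ 0 := by
  rw [qC_two]; intro h
  have := congrArg (fun q : ℤ[X] => q.coeff 4) h
  simp [coeff_X] at this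

/-- `(qC a 2).coeff 4 = 1`. -/
theorem coeff_qC_two_four (a : ℤ) : (qC a 2).coeff 4 = 1 := by
  rw [qC_two]; simp [coeff_X]

/-- `(qC a 1).coeff 1 = 2`. -/
theorem coeff_qC_one_one (a : ℤ) : (qC a 1).coeff 1 = 2 := by
  rw [qC_one]; simp only [coeff_neg, coeff_add, coeff_sub, coeff_C_mul, coeff_X_pow, coeff_X, coeff_C]; norm_num

/-- `(qC a 2).natDegree = 4`. -/
theorem natDegree_qC_two (a : ℤ) : (qC a 2).natDegree = 4 := by rw [qC_two]; compute_degree!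

/-- `(qC a 1).natDegree ≤ 2`. -/
theorem natDegree_qC_one_le (a : ℤ) : (qC a 1).natDegree ≤ 2 := by
  rw [qC_one, natDegree_neg]; compute_degree

/-- `(qC a 0).natDegree = 1`. -/
theorem natDegree_qC_zero (a : ℤ) : (qC a 0).natDegree = 1 := by
  rw [qC_zero]; compute_degree!

/-- `xdeg (Qa a) = 2`. -/
theorem xdeg_Qa (a : ℤ) : xdeg (Qa a) = 2 := by
  rw [Qa_eq_xPolyP]; exact xdeg_xPolyP 2 _ (qC_two_ne_zero a)

/-- `topX (Qa a) = qC a 2`. -/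
theorem topX_Qa (a : ℤ) : topX (Qa a) = qC a 2 := by
  rw [Qa_eq_xPolyP, topX_xPolyP 2 _ (qC_two_ne_zero a)]

/-- `xCoeff (Qa a) 2 = qC a 2`. -/
theorem xCoeff_Qa_two (a : ℤ) : xCoeff (Qa a) 2 = qC a 2 := by
  rw [Qa_eq_xPolyP, xCoeff_xPolyP]; simp

/-- `xCoeff (Qa a) 0 = qC a 0`. -/
theorem xCoeff_Qa_zero (a : ℤ) : xCoeff (Qa a) 0 = qC a 0 := by
  rw [Qa_eq_xPolyP, xCoeff_xPolyP]; simp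

/-- `deg_Y (Qa a) = 4`. -/
theorem natDegree_Qa (a : ℤ) : (Qa a).natDegree = 4 := by
  refine le_antisymm ?_ (le_natDegree_of_ne_zero fun h => ?_)
  · rw [Qa_eq_xPolyP]
    refine natDegree_xPolyP_le 2 _ 4 fun j hj => ?_
    interval_cases j
    · rw [natDegree_qC_zero]; norm_num
    · exact (natDegree_qC_one_le a).trans (by norm_num)
    · rw [natDegree_qC_two]
  · have h1 := congrArg (fun q : ℤ[X] => q.coeff 2) h
    simp only [Qa_eq_xPolyP, coeff_coeff_xPolyP, coeff_zero] at h1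
    rw [if_pos (by simp), coeff_qC_two_four] at h1
    exact one_ne_zero h1

/-- `Qa a ≠ 0`. -/
theorem Qa_ne_zero (a : ℤ) : Qa a ≠ 0 := fun h => by
  have := natDegree_Qa a; rw [h, natDegree_zero] at this; exact absurd this (by norm_num)

/-- the point `(∞, ∞)` has order `eTop = 0`. -/
theorem eTop_Qa (a : ℤ) : eTop (Qa a) = 0 := by
  rw [eTop, natDegree_Qa, topX_Qa, natDegree_qC_two]

/-- `Qa a` has NO x-linear presentation (`x`-degree `2`). -/
theorem Qa_ne_xLinP (a : ℤ) (A B : ℤ[X]) : Qa a ≠ xLinP A B := by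
  intro hP
  have h := fun x : ℝ => congrArg (fun Q => bev Q x 0) hP
  have h0 : ((a : ℝ) - 0 * ((0 : ℝ) ^ 2 + 2)) ^ 2 - 0 * (0 - 1) ^ 2 = aeval (0 : ℝ) A + 0 * aeval (0 : ℝ) B := by
    have := h 0; simp only [bev_Qa, bev_xLinP] at this; exact this
  have h1 : ((a : ℝ) - 1 * ((0 : ℝ) ^ 2 + 2)) ^ 2 - 0 * (1 - 1) ^ 2 = aeval (0 : ℝ) A + 1 * aeval (0 : ℝ) B := by
    have := h 1; simp only [bev_Qa, bev_xLinP] at this; exact this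
  have h2 : ((a : ℝ) - 2 * ((0 : ℝ) ^ 2 + 2)) ^ 2 - 0 * (2 - 1) ^ 2 = aeval (0 : ℝ) A + 2 * aeval (0 : ℝ) B := by
    have := h 2; simp only [bev_Qa, bev_xLinP] at this; exact this
  have : (8 : ℝ) = 0 := by linear_combination h0 - 2 * h1 + h2
  norm_num at this

/-- `¬ XLinearLt (Qa a)` (x-degree `2`: not of node 3's x-linear shape). -/
theorem not_xLinearLt_Qa (a : ℤ) : ¬ XLinearLt (Qa a) := fun ⟨A, B, _, _, hP⟩ => Qa_ne_xLinP a A B hP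

/-- **`¬ XLinTM (Qa a)`**: outside node 16's record class (which is x-linear by statement). -/
theorem not_xLinTM_Qa (a : ℤ) : ¬ XLinTM (Qa a) := fun ⟨A, B, _, _, _, _, hP⟩ => Qa_ne_xLinP a A B hP

/-- not a conjugate-poles shape curve of node 10 (those are x-linear). -/
theorem Qa_ne_normShapeCurve (a : ℤ) (g q : ℤ[X]) (n : ℕ) (D : ℤ) : Qa a ≠ normShapeCurve g q n D := by
  rw [normShapeCurve_eq_xLinP]; exact Qa_ne_xLinP a _ _

/-- `Qa a` is NOT a two-term curve `x^k·B(Y) − A(Y)` (the `x`-support is `{0, 1, 2}`). -/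
theorem Qa_ne_twoTermP (a : ℤ) (k : ℕ) (B A : ℤ[X]) : Qa a ≠ twoTermP k B A := by
  intro h
  have hc : ∀ i j : ℕ, (if j ∈ Finset.range 3 then (qC a j).coeff i else 0) =
      ((if j = k then B.coeff i else 0) - (if j = 0 then A.coeff i else 0)) := by
    intro i j
    rw [← coeff_coeff_xPolyP, ← coeff_coeff_twoTermP, ← h, Qa_eq_xPolyP]
  by_cases hk : k = 1
  · subst hk
    have h42 := hc 4 2
    rw [if_pos (by simp), if_neg (by norm_num), if_neg (by norm_num), coeff_qC_two_four] at h42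
    simp at h42
  · have h11 := hc 1 1
    rw [if_pos (by simp), if_neg (fun h => hk h.symm), if_neg (by norm_num), coeff_qC_one_one] at h11
    simp at h11

/-- `aeval z (qC a 2) = z ^ 4 + 4 * z ^ 2 - z + 4` in any commutative `ℤ`-algebra. -/
theorem aeval_qC_two {A : Type*} [CommRing A] [Algebra ℤ A] (a : ℤ) (z : A) :
    aeval z (qC a 2) = z ^ 4 + 4 * z ^ 2 - z + 4 := by
  rw [qC_two]
  simp only [map_add, map_sub, map_mul, map_pow, aeval_X, aeval_C]
  simp only [eq_intCast, Int.cast_ofNat]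

/-- `aeval z (derivative (qC a 2)) = 4 * z ^ 3 + 8 * z - 1`. -/
theorem aeval_derivative_qC_two {A : Type*} [CommRing A] [Algebra ℤ A] (a : ℤ) (z : A) :
    aeval z (derivative (qC a 2)) = 4 * z ^ 3 + 8 * z - 1 := by
  rw [qC_two]
  simp only [derivative_mul, derivative_X_pow, derivative_X, derivative_C, zero_mul, zero_add, add_zero, map_add, map_sub,
    map_mul, map_pow, map_natCast, aeval_X, aeval_C, map_one]
  simp only [eq_intCast, Int.cast_ofNat]
  norm_num; ring

/-- the top `Y⁴ + 4Y² − Y + 4` has NO RATIONAL ROOT (indeed no real root: `(q² + 2)² > q`). -/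
theorem aeval_qC_two_ne_zero_rat (a : ℤ) (q : ℚ) : aeval q (qC a 2) ≠ 0 := by
  rw [aeval_qC_two]
  nlinarith [sq_nonneg (q ^ 2), sq_nonneg (8 * q - 1), sq_nonneg q]

/-- the top HAS a root in `ℤ₂` (Hensel at `0`: `‖4‖₂ = 2^{−2} < ‖−1‖₂² = 1`). -/
theorem exists_padic_root_qC_two (a : ℤ) : ∃ z : ℚ_[2], aeval z (qC a 2) = 0 := by
  have h2 : ‖(2 : ℤ_[2])‖ = 1 / 2 := by
    have := PadicInt.norm_p (p := 2); simpa using this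
  have h4 : ‖(4 : ℤ_[2])‖ = 1 / 4 := by
    rw [show (4 : ℤ_[2]) = 2 ^ 2 by norm_num, norm_pow, h2]; norm_num
  have hF : ‖aeval (0 : ℤ_[2]) (qC a 2)‖ < ‖aeval (0 : ℤ_[2]) (derivative (qC a 2))‖ ^ 2 := by
    have e1 : aeval (0 : ℤ_[2]) (qC a 2) = 4 := by
      rw [aeval_qC_two]; norm_num
    have e2 : aeval (0 : ℤ_[2]) (derivative (qC a 2)) = -1 := by
      rw [aeval_derivative_qC_two]; norm_num
    rw [e1, e2, norm_neg, norm_one, h4]; norm_num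
  obtain ⟨z, hz, -⟩ := hensels_lemma hF
  refine ⟨(z : ℚ_[2]), ?_⟩
  have := Polynomial.aeval_algebraMap_apply ℚ_[2] z (qC a 2)
  rw [hz, map_zero] at this
  simpa using this

/-- the top is SEPARABLE over `ℚ` (`2021 = (144Y² + 1024Y + 384)·c₂ − (36Y³ + 256Y² + 168Y + 485)·c₂'`). -/
theorem separable_qC_two (a : ℤ) : ((qC a 2).map (Int.castRingHom ℚ)).Separable := by
  rw [Polynomial.separable_def, derivative_map]
  refine (Polynomial.isCoprime_iff_aeval_ne_zero_of_isAlgClosed (k := ℚ) (K := ℂ) _ _).mpr fun z => ?_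
  rw [← algebraMap_int_eq, aeval_map_algebraMap, aeval_map_algebraMap, aeval_qC_two, aeval_derivative_qC_two]
  by_contra h
  simp only [not_or, not_not] at h
  obtain ⟨h1, h2⟩ := h
  have : (2021 : ℂ) = 0 := by
    linear_combination (384 + 1024 * z + 144 * z ^ 2) * h1 + (-485 - 168 * z - 256 * z ^ 2 - 36 * z ^ 3) * h2
  norm_num at this

/-- in EVERY presentation `Qa a = Σ_{j ≤ k} x^j c_j(Y)` the top `c_k` has a `ℚ₂`-root (it is `qC a 2` or `0`). -/
theorem exists_padic_root_top_of_Qa_eq (a : ℤ) (k : ℕ) (c : ℕ → ℤ[X]) (h : Qa a = xPolyP k c) :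
    ∃ z : ℚ_[2], aeval z (c k) = 0 := by
  by_cases hck : c k = 0
  · exact ⟨0, by rw [hck, map_zero]⟩
  · have h1 := topX_Qa a
    rw [h, topX_xPolyP k c hck] at h1
    rw [h1]; exact exists_padic_root_qC_two a

/-- `¬ RootlessTop e (Qa a)` for every `e` (the top `qC a 2` has a `ℚ₂`-root). -/
theorem not_rootlessTop_Qa (a : ℤ) (e : ℕ) : ¬ RootlessTop e (Qa a) := by
  rintro ⟨k, c, -, hroot, h⟩
  obtain ⟨z, hz⟩ := exists_padic_root_top_of_Qa_eq a k c h
  exact hroot z hz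

/-- **`¬ DecidedAt 2 (Qa a)`** — each of the five disjuncts refuted by name. -/
theorem not_decidedAt_two_Qa (a : ℤ) : ¬ DecidedAt 2 (Qa a) := by
  rintro (h | h | h | h | h)
  · rw [natDegree_Qa] at h; omega
  · exact not_xLinearLt_Qa a h
  · exact absurd h.1 (by norm_num)
  · have := three_le_thinThreshold (Qa a); omega
  · exact not_rootlessTop_Qa a 1 h

/-- **`¬ LocalAt m₀ (Qa a)` for `m₀ ≤ 2`** (irrational `ℚ₂`-root of the top in every presentation). -/
theorem not_localAt_Qa (a : ℤ) {m₀ : ℕ} (hm : m₀ ≤ 2) : ¬ LocalAt m₀ (Qa a) := fun h => by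
  have hR := rootCond_topX_of_localAt h
  rw [topX_Qa] at hR
  obtain ⟨z, hz⟩ := exists_padic_root_qC_two a
  exact not_rootCond_of_padic_root _ (qC_two_ne_zero a) hz (aeval_qC_two_ne_zero_rat a) hm hR

/-- **`¬ GaussAt m₀ (Qa a)`** (node 15's dominance fails at `j = 2`: `deg c₂ = 4 > 1 = deg c₀`). -/
theorem not_gaussAt_Qa (a : ℤ) (m₀ : ℕ) : ¬ GaussAt m₀ (Qa a) := by
  rintro ⟨-, hdom, -⟩
  have := hdom 2 (by norm_num) (by rw [xdeg_Qa])
  rw [xCoeff_Qa_two, xCoeff_Qa_zero, natDegree_qC_two, natDegree_qC_zero] at this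
  omega

/-- **`¬ HeightDecidedAt 2 (Qa a)`** (`deg_Y = 4 = 2·xdeg`: node 12/13's height inequality is NOT strict here —
the class lies exactly beyond the height machine's cap `e·m₀ > n`). -/
theorem not_heightDecidedAt_two_Qa (a : ℤ) : ¬ HeightDecidedAt 2 (Qa a) := by
  rintro ⟨-, hlt⟩
  rw [xdeg_Qa, natDegree_Qa] at hlt
  omega

/-- … while `Qa a` IS in node 11's CONDITIONAL subspace class at `m₀ = 2` (separable top, `eTop = 0`), as `M17P`. -/
theorem sepTopAt_two_Qa (a : ℤ) : SepTopAt 2 (Qa a) := by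
  refine ⟨?_, ?_⟩
  · rw [topX_Qa]; exact separable_qC_two a
  · rw [eTop_Qa]; norm_num

/-- **THE INFINITE x-DEGREE-2 FAMILY OF RE-AMENDED-FRONTIER MEMBERS MADE UNCONDITIONAL, uniform in `a ∈ ℤ`:**
`x`-degree `2`, `Y`-degree `4`, separable top with an irrational `ℚ₂`-root and no rational root, `eTop = 0`;
`¬ DecidedAt 2`, `¬ LocalAt 2`, `¬ GaussAt 2`, `¬ HeightDecidedAt 2`, `¬ XLinTM`, not two-term, not of norm shape,
`3 ≤ thinThreshold`, `SepTopAt 2` (conditional class only) — AND `LevelFinite (Qa a)`, `ThinFibreAt m₀ (Qa a)` for every `m₀`. -/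
theorem Qa_territory (a : ℤ) :
    xdeg (Qa a) = 2 ∧ (Qa a).natDegree = 4 ∧ (∃ z : ℚ_[2], aeval z (topX (Qa a)) = 0) ∧
      (∀ q : ℚ, aeval q (topX (Qa a)) ≠ 0) ∧ ((topX (Qa a)).map (Int.castRingHom ℚ)).Separable ∧
      ¬ DecidedAt 2 (Qa a) ∧ ¬ LocalAt 2 (Qa a) ∧ ¬ GaussAt 2 (Qa a) ∧ ¬ HeightDecidedAt 2 (Qa a) ∧ ¬ XLinTM (Qa a) ∧
      (∀ k B A, Qa a ≠ twoTermP k B A) ∧ (∀ g q n D, Qa a ≠ normShapeCurve g q n D) ∧ 3 ≤ thinThreshold (Qa a) ∧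
      SepTopAt 2 (Qa a) ∧ LevelFinite (Qa a) ∧ ∀ m₀, ThinFibreAt m₀ (Qa a) := by
  refine ⟨xdeg_Qa a, natDegree_Qa a, ?_, ?_, ?_, not_decidedAt_two_Qa a, not_localAt_Qa a le_rfl, not_gaussAt_Qa a 2,
    not_heightDecidedAt_two_Qa a, not_xLinTM_Qa a, Qa_ne_twoTermP a, Qa_ne_normShapeCurve a, three_le_thinThreshold _,
    sepTopAt_two_Qa a, levelFinite_Qa a, thinFibreAt_Qa a⟩
  · rw [topX_Qa]; exact exists_padic_root_qC_two a
  · rw [topX_Qa]; exact aeval_qC_two_ne_zero_rat a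
  · rw [topX_Qa]; exact separable_qC_two a

end Summit.Schanuel.Schanuel.Theorems.RootDecomp1KParamThueMahler

end
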